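import Summits.RiemannHypothesis.RiemannHypothesis.Theses.RobinFullPortrait
import Summits.RiemannHypothesis.RiemannHypothesis.Theorems.RobinFullPortraitMertensRemainder
import Summits.RiemannHypothesis.RiemannHypothesis.Theorems.RobinFullPortraitAssembly
import Summits.RiemannHypothesis.RiemannHypothesis.Theorems.RobinFullPortraitRangeLeg
import HarnessLib

/-!
# `RobinFullPortrait.AnalyticLegTwentySix` (item stmt-RiemannHypothesis-24270) — L50 «ROBIN · 26-FULL PORTRAIT», the analytic leg

The ONE open obligation of route `RobinFullPortrait` (RECORD class, column ROBIN, rung family (ix);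
director-rh ruling (F) 2026-08-28: «toward RiemannHypothesis: 0»): under Büthe 2018 (Thm 2) and
Broadbent–Kadiri–Lumley–Ng–Wilk 2021 (§1.2), for every prime `q ≥ x₀ = 2^61 − 1 = 2 305 843 009 213 693 951`
the Solé–Planat primorial product at `t = 26` satisfies

  `∏_{p ≤ q} (1 + 1/p + ⋯ + 1/p²⁵) < e^γ log θ(q)`.

This is the Ventures `t = 24` certificate `Summit.Ventures.RobinTFree.primorial_bound_24` (cell rh-explicit,
ROBIN track; file `Summits/Ventures/RobinTFree/RobinTFree24.lean`, not imported) re-run VERBATIM at `(t, x₀) = (26, 2^61 − 1)` instead of `(24, 29 996 208 012 611)`: the tree's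
majorants `mertensRemainder_le_E1` / `mertensRemainder_le_E2` of Rosser–Schoenfeld's remainder in Mertens'
product (`prod_one_sub_inv_inv_le`) are evaluated with the lower bounds (all logarithms enter through LOWER
bounds only) `log x₀ ≥ 60 log 2 ≥ 41.58`, `√x₀ ≥ 1 518 500 249`, `log 10¹⁹ ≥ 63 log 2 ≥ 43.66`, giving
`E(q) ≤ 1.08·10⁻⁸` (`q ≤ 10¹⁹`) resp. `≤ 1.12·10⁻⁸` (`q > 10¹⁹`) for ANY relative constant `0 ≤ c ≤ 4·10⁻⁵`
(BKLNW's display `3.79·10⁻⁵`), both below `2⁻²⁶ = 1.4901·10⁻⁸`, while the `θ`-windows cost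
`1.29·10⁻⁹` resp. `2.10·10⁻⁸ ≪ log x₀ · (2⁻²⁶ − E) ≈ 1.7·10⁻⁷`.  (`t = 27` does NOT close with these two
prints: `2⁻²⁷ = 7.45·10⁻⁹ < K ≈ 1.0·10⁻⁸`; recorded as the ceiling in the route file, not attempted.)
(The primality of `2^61 − 1`, needed only by the t-free reduction inside `Assembly` ✓, is the tree's
`prime_2305843009213693951`.)

With `RangeLeg` (✓ `rangeLeg_proof`) and `Assembly` (✓ `assembly_proof`) this closes the route's RH-free target
`Portrait` (see `portrait_proof` below): a least Robin violator `N > 5040` is superabundant, `2^26 ∣ N` and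
`log N > 0.99947·(10¹⁹ − 1)` — CONDITIONAL bookkeeping on the two printed θ-facts and `RiemannHypothesisUpTo
1.82·10¹⁰` (all in hypothesis position, not discharged).  In print the t-free class is `t = 21` (Axler 2023,
Thm 1.2); the tree had `t = 24` (Ventures).  Nothing here bears on the truth of RH; RH is NOT proved by this.
Route lead rlead-rh-RobinFullPortrait g0 (D-0172) filing.

## Layout
The remainder majorants `mertensRemainder_le_E1` / `mertensRemainder_le_E2` (and `thetaRelBound_of_bklnw`,
`integrableOn_theta_sub_mul_weight_Ioi`) come from the support file
`Theorems/RobinFullPortraitMertensRemainder.lean` (namespace `…Theorems.RobinFullPortrait.MertensRemainder`),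
a verbatim vendoring of the Ventures proof file `Summits/Ventures/RobinTFree/RobinTFreeRemainderBounds.lean`
made necessary because that module is not in the Lean farm's built snapshot (2026-08-30).  This file is the
new `t = 26` certificate only.

## References
* P. Solé, M. Planat, Integers 12 (2012) A65, Prop. 2. [SolePlanat2012]
* T. Morrill, D. Platt, Integers 21 (2021) A28, Lemmas 4–5. [MorrillPlatt2021]
* C. Axler, Ramanujan J. 61 (2023), Thm 1.2. [Axler2023Robin]
* J. Büthe, Math. Comp. 87 (2018), Thm 2. [Buthe2018]
* S. Broadbent, H. Kadiri, A. Lumley, N. Ng, K. Wilk, Math. Comp. 90 (2021), §1.2. [BKLNW2021]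
-/

set_option linter.dupNamespace false  -- the mandated namespace repeats `RiemannHypothesis`

noncomputable section

namespace Summit.RiemannHypothesis.RiemannHypothesis.Theorems.RobinFullPortrait

/-! ## The `t = 26` certificate at `x₀ = 2^61 − 1` -/

section Leg

open Real
open scoped Chebyshev
open Literature.NumberTheory.LFunctions Literature.NumberTheory.LFunctions.RobinTFree
open MertensRemainder

/-! ### Numerical lower bounds at `x₀ = 2^61 − 1` and at `10¹⁹` -/

/-- `log q ≥ 41.58` for `q ≥ 2^61 − 1` (`2^61 − 1 ≥ 2⁶⁰`, `log 2 > 0.6931471803`). [folklore] -/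
theorem log_x0_ge {q : ℝ} (hq : (2305843009213693951 : ℝ) ≤ q) : (41.58 : ℝ) ≤ Real.log q := by
  have h2 : (2:ℝ) ^ 60 ≤ q := le_trans (by norm_num) hq
  have := Real.log_le_log (by positivity) h2
  rw [Real.log_pow] at this
  have hl2 := Real.log_two_gt_d9
  push_cast at this
  linarith

/-- `√q ≥ 1 518 500 249` for `q ≥ 2^61 − 1` (`1518500249² ≤ 2^61 − 1`). [folklore] -/
theorem sqrt_x0_ge {q : ℝ} (hq : (2305843009213693951 : ℝ) ≤ q) : (1518500249 : ℝ) ≤ √q :=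
  Real.le_sqrt_of_sq_le (le_trans (by norm_num) hq)

/-- `log q ≥ 43.66` for `q ≥ 10¹⁹` (`10¹⁹ ≥ 2⁶³`). [folklore] -/
theorem log_ge_of_ten_pow_19_le {q : ℝ} (hq : (10 : ℝ) ^ 19 ≤ q) : (43.66 : ℝ) ≤ Real.log q := by
  have h2 : (2:ℝ) ^ 63 ≤ q := le_trans (by norm_num) hq
  have := Real.log_le_log (by positivity) h2
  rw [Real.log_pow] at this
  have hl2 := Real.log_two_gt_d9
  push_cast at this
  linarith

/-! ### The Dedekind product at `t = 26` versus Mertens' product -/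

/-- `dedekindFactor t p = (1 − p^{−t}) (1 − 1/p)⁻¹` for `p ≥ 2` (geometric sum; verbatim the Ventures lemma
`Summit.Ventures.RobinTFree.dedekindFactor_eq`, restated here to keep the import cone to the remainder-bounds
file). [cite: SolePlanat2012, §1] -/
theorem dedekindFactor_eq_geom {t p : ℕ} (hp : 2 ≤ p) :
    dedekindFactor t p = (1 - ((p : ℝ)⁻¹) ^ t) * (1 - (p : ℝ)⁻¹)⁻¹ := by
  unfold dedekindFactor
  have hp1 : (p : ℝ)⁻¹ ≠ 1 := by
    have : (1 : ℝ) < p := by exact_mod_cast hp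
    exact ne_of_lt (inv_lt_one_of_one_lt₀ this)
  rw [geom_sum_eq hp1]
  have h1 : (p : ℝ)⁻¹ - 1 ≠ 0 := sub_ne_zero.mpr hp1
  have h2 : 1 - (p : ℝ)⁻¹ ≠ 0 := fun h => h1 (by linarith)
  rw [div_eq_mul_inv, show ((p : ℝ)⁻¹ - 1)⁻¹ = -(1 - (p : ℝ)⁻¹)⁻¹ by
    rw [← inv_neg]; congr 1; ring]
  ring


/-- `∏_{p≤q} dedekindFactor 26 p ≤ (1 − 2⁻²⁶) · ∏_{p≤q} (1 − 1/p)⁻¹` for `q ≥ 2` (drop every factor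
`1 − p⁻²⁶ ≤ 1` except the one at `p = 2`). [folklore] -/
theorem prod_dedekindFactor_26_le {q : ℕ} (hq : 2 ≤ q) :
    ∏ p ∈ Nat.primesLE q, dedekindFactor 26 p ≤
      (1 - (2 : ℝ)⁻¹ ^ 26) * ∏ p ∈ Nat.primesLE q, (1 - (p : ℝ)⁻¹)⁻¹ := by
  have hprime : ∀ p ∈ Nat.primesLE q, p.Prime := fun p hp => (Nat.mem_primesLE.1 hp).2
  rw [Finset.prod_congr rfl fun p hp => dedekindFactor_eq_geom (hprime p hp).two_le,
    Finset.prod_mul_distrib]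
  refine mul_le_mul_of_nonneg_right ?_ (Finset.prod_nonneg fun p hp => ?_)
  · have h2 : 2 ∈ Nat.primesLE q := Nat.mem_primesLE.2 ⟨hq, Nat.prime_two⟩
    rw [← Finset.mul_prod_erase _ _ h2]
    push_cast
    refine mul_le_of_le_one_right (by norm_num) (Finset.prod_le_one (fun p hp => ?_) fun p hp => ?_)
    · have hp := (hprime p (Finset.mem_of_mem_erase hp)).pos
      have : ((p:ℝ)⁻¹) ^ 26 ≤ 1 := pow_le_one₀ (by positivity)
        (inv_le_one_of_one_le₀ (by exact_mod_cast hp))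
      linarith
    · have : 0 ≤ ((p:ℝ)⁻¹) ^ 26 := by positivity
      linarith [pow_le_one₀ (n := 26) (by positivity : (0:ℝ) ≤ (p:ℝ)⁻¹)
        (inv_le_one_of_one_le₀ (by exact_mod_cast (hprime p (Finset.mem_of_mem_erase hp)).pos))]
  · have hp2 : (2 : ℝ) ≤ p := by exact_mod_cast (hprime p hp).two_le
    have : (p : ℝ)⁻¹ ≤ 1 / 2 := by rw [inv_eq_one_div]; exact one_div_le_one_div_of_le (by norm_num) hp2
    have : 0 < 1 - (p : ℝ)⁻¹ := by linarith
    positivity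

/-! ### The remainder majorants at `x₀ = 2^61 − 1` -/

/-- `E1(c, q) = −0.05/(√q log q) + 3.9 (1 + log q)/(√q log² q) + c (1/(2 log²10¹⁹) + 1/(3 log³10¹⁹)) ≤ 1.08·10⁻⁸`
for `q ≥ 2^61 − 1` and `0 ≤ c ≤ 4·10⁻⁵` (the majorant of `mertensRemainder_le_E1`). [folklore] -/
theorem E1_le_x0 {c q : ℝ} (hc0 : 0 ≤ c) (hc : c ≤ 4e-5) (hq : (2305843009213693951 : ℝ) ≤ q) :
    -0.05 / (√q * Real.log q) + 3.9 * (1 + Real.log q) / (√q * Real.log q ^ 2) +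
        c * (1 / (2 * Real.log ((10 : ℝ) ^ 19) ^ 2) + 1 / (3 * Real.log ((10 : ℝ) ^ 19) ^ 3)) ≤
      1.08e-8 := by
  have hL := log_x0_ge hq
  have hs := sqrt_x0_ge hq
  have hLX := log_ge_of_ten_pow_19_le (le_refl ((10:ℝ) ^ 19))
  have hL0 : (0:ℝ) < Real.log q := by linarith
  have hs0 : (0:ℝ) < √q := by linarith
  have hM0 : (0:ℝ) < Real.log ((10:ℝ) ^ 19) := lt_of_lt_of_le (by norm_num) hLX
  set L := Real.log q with hLdef
  set s := √q with hsdef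
  set M := Real.log ((10:ℝ) ^ 19) with hMdef
  have e1 : -0.05 / (s * L) + 3.9 * (1 + L) / (s * L ^ 2) = (3.9 / L ^ 2 + 3.85 / L) / s := by
    field_simp; ring
  have b3 : (3.9 / L ^ 2 + 3.85 / L) / s ≤ (3.9 / 41.58 ^ 2 + 3.85 / 41.58) / 1518500249 := by
    calc (3.9 / L ^ 2 + 3.85 / L) / s ≤ (3.9 / L ^ 2 + 3.85 / L) / 1518500249 := by gcongr
      _ ≤ _ := by gcongr
  have b4 : c * (1 / (2 * M ^ 2) + 1 / (3 * M ^ 3)) ≤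
      4e-5 * (1 / (2 * 43.66 ^ 2) + 1 / (3 * 43.66 ^ 3)) := by
    calc c * (1 / (2 * M ^ 2) + 1 / (3 * M ^ 3)) ≤ c * (1 / (2 * 43.66 ^ 2) + 1 / (3 * 43.66 ^ 3)) := by
          gcongr
      _ ≤ 4e-5 * (1 / (2 * 43.66 ^ 2) + 1 / (3 * 43.66 ^ 3)) := by gcongr
  rw [e1]
  have : (3.9 / 41.58 ^ 2 + 3.85 / 41.58) / 1518500249 +
      4e-5 * (1 / (2 * 43.66 ^ 2) + 1 / (3 * 43.66 ^ 3)) ≤ (1.08e-8 : ℝ) := by norm_num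
  linarith

/-- `E2(c, q) = c (4/(3 log³q) + 1/(2 log²q)) ≤ 1.12·10⁻⁸` for `q ≥ 10¹⁹` and `0 ≤ c ≤ 4·10⁻⁵` (the majorant
of `mertensRemainder_le_E2`). [folklore] -/
theorem E2_le_sharp {c q : ℝ} (hc0 : 0 ≤ c) (hc : c ≤ 4e-5) (hq : (10:ℝ) ^ 19 ≤ q) :
    c * (4 / (3 * Real.log q ^ 3) + 1 / (2 * Real.log q ^ 2)) ≤ 1.12e-8 := by
  have hL := log_ge_of_ten_pow_19_le hq
  have hL0 : (0:ℝ) < Real.log q := by linarith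
  calc c * (4 / (3 * Real.log q ^ 3) + 1 / (2 * Real.log q ^ 2))
      ≤ c * (4 / (3 * 43.66 ^ 3) + 1 / (2 * 43.66 ^ 2)) := by gcongr
    _ ≤ 4e-5 * (4 / (3 * 43.66 ^ 3) + 1 / (2 * 43.66 ^ 2)) := by gcongr
    _ ≤ 1.12e-8 := by norm_num

/-! ### The analytic inequality at primorials `q#`, `q ≥ 2^61 − 1`, exponent `t = 26` -/

/-- **The analytic leg at `(t, x₀) = (26, 2^61 − 1)`**: under Büthe's θ-bounds and any relative bound
`|θ(x) − x| < c·x/log²x` (`x ≥ 10¹⁹`, `0 ≤ c ≤ 4·10⁻⁵`), for every prime `q ≥ 2^61 − 1`,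
`∏_{p≤q} (1 + 1/p + ⋯ + 1/p²⁵) < e^γ log θ(q)` (Solé–Planat / Morrill–Platt / Axler criterion at
`t = 26`; the Ventures certificate `primorial_bound_24` re-run at the Mersenne prime `2^61 − 1`; new). -/
theorem primorial_bound_26 (hB : Buthe2018_thm2_theta) {c : ℝ} (hc0 : 0 ≤ c) (hc : c ≤ 4e-5)
    (hK : ∀ x : ℝ, (10 : ℝ) ^ 19 ≤ x → |θ x - x| < c * x / Real.log x ^ 2)
    {q : ℕ} (hq : q.Prime) (hq0 : 2305843009213693951 ≤ q) :
    ∏ p ∈ Nat.primesLE q, dedekindFactor 26 p <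
      Real.exp eulerMascheroniConstant * Real.log (θ (q : ℝ)) := by
  have hqR : (2305843009213693951 : ℝ) ≤ q := by exact_mod_cast hq0
  have hq2 : (2 : ℝ) ≤ q := le_trans (by norm_num) hqR
  have hq1423 : (1423 : ℝ) ≤ q := le_trans (by norm_num) hqR
  have hq1 : (1 : ℝ) < q := by linarith
  have hL := log_x0_ge hqR
  have hs := sqrt_x0_ge hqR
  have hL0 : 0 < Real.log (q:ℝ) := by linarith
  have hs0 : 0 < √(q:ℝ) := by linarith
  set L := Real.log (q : ℝ) with hLdef
  -- two elementary inequalities: `exp E ≤ 1 + E + E²` (`|E| ≤ 1`) and `log(1 − u) ≥ −u/(1 − u)` (`u < 1`)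
  have exp_le_quad : ∀ {E : ℝ}, |E| ≤ 1 → Real.exp E ≤ 1 + E + E ^ 2 := fun {E} hE => by
    have := Real.abs_exp_sub_one_sub_id_le hE
    have := (abs_le.1 this).2
    linarith
  have log_one_sub_ge : ∀ {u : ℝ}, u < 1 → -(u / (1 - u)) ≤ Real.log (1 - u) := fun {u} hu1 => by
    have hpos : 0 < 1 - u := by linarith
    have := Real.one_sub_inv_le_log_of_pos hpos
    have e : 1 - (1 - u)⁻¹ = -(u / (1 - u)) := by field_simp; ring
    linarith [e]
  -- Mertens with remainder
  have hint := integrableOn_theta_sub_mul_weight_Ioi hK hq1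
  have hM := prod_one_sub_inv_inv_le hq2 hint
  rw [Nat.floor_natCast] at hM
  have hD := prod_dedekindFactor_26_le (q := q) (by exact_mod_cast hq.two_le)
  have hγ : 0 < Real.exp eulerMascheroniConstant := Real.exp_pos _
  set P := ∏ p ∈ Nat.primesLE q, (1 - (p : ℝ)⁻¹)⁻¹ with hPdef
  set E := mertensRemainder (q : ℝ) with hEdef
  have c26 : (1 - (2 : ℝ)⁻¹ ^ 26) = 1 - 1.490116119384765625e-8 := by norm_num
  have hP0 : 0 ≤ P := by
    refine Finset.prod_nonneg fun p hp => ?_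
    have hp2 : (2 : ℝ) ≤ p := by exact_mod_cast (Nat.mem_primesLE.1 hp).2.two_le
    have : (p : ℝ)⁻¹ ≤ 1 / 2 := by rw [inv_eq_one_div]; exact one_div_le_one_div_of_le (by norm_num) hp2
    have : 0 < 1 - (p : ℝ)⁻¹ := by linarith
    positivity
  by_cases hcase : (q : ℝ) ≤ (10:ℝ) ^ 19
  · -- Büthe regime `2^61 − 1 ≤ q ≤ 10¹⁹`
    have hE : E ≤ 1.08e-8 := (mertensRemainder_le_E1 hB hK hq1423 hcase).trans (E1_le_x0 hc0 hc hqR)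
    have hexp : Real.exp E ≤ 1 + 1.08e-8 + 1.08e-8 ^ 2 := by
      have hE' : |E| ≤ 1 ∨ E < -1 := by
        by_cases h : -1 ≤ E
        · exact Or.inl (abs_le.2 ⟨h, by linarith⟩)
        · exact Or.inr (by linarith)
      rcases hE' with h | h
      · calc Real.exp E ≤ 1 + E + E ^ 2 := exp_le_quad h
          _ ≤ 1 + 1.08e-8 + 1.08e-8 ^ 2 := by nlinarith [abs_le.1 h]
      · calc Real.exp E ≤ Real.exp 0 := Real.exp_le_exp.2 (by linarith)
          _ ≤ _ := by norm_num
    -- θ(q) ≥ q − 1.95 √q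
    have hθ : (q : ℝ) - 1.95 * √(q:ℝ) ≤ θ (q : ℝ) := by linarith [hB.1 (q:ℝ) hq1423 hcase]
    have hu : 1.95 / √(q:ℝ) ≤ 1.95 / 1518500249 := by gcongr
    have hu1 : 1.95 / √(q:ℝ) < 1 := lt_of_le_of_lt hu (by norm_num)
    have hu0 : 0 ≤ 1.95 / √(q:ℝ) := by positivity
    have e : (q : ℝ) - 1.95 * √(q:ℝ) = (q:ℝ) * (1 - 1.95 / √(q:ℝ)) := by
      have hsq : (q:ℝ) = √(q:ℝ) * √(q:ℝ) := (Real.mul_self_sqrt (by linarith)).symm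
      have hdiv : (q:ℝ) / √(q:ℝ) = √(q:ℝ) := by rw [div_eq_iff hs0.ne']; exact hsq
      calc (q : ℝ) - 1.95 * √(q:ℝ) = (q:ℝ) - 1.95 * ((q:ℝ) / √(q:ℝ)) := by rw [hdiv]
        _ = (q:ℝ) * (1 - 1.95 / √(q:ℝ)) := by ring
    have hθpos : 0 < (q : ℝ) - 1.95 * √(q:ℝ) := by
      rw [e]; exact mul_pos (by linarith) (by linarith)
    have hlogθ : L + Real.log (1 - 1.95 / √(q:ℝ)) ≤ Real.log (θ (q:ℝ)) := by
      calc L + Real.log (1 - 1.95 / √(q:ℝ)) = Real.log ((q:ℝ) * (1 - 1.95 / √(q:ℝ))) := by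
            rw [Real.log_mul (by linarith) (by linarith)]
        _ ≤ Real.log (θ (q:ℝ)) := Real.log_le_log (by rw [← e]; exact hθpos) (by rw [← e]; exact hθ)
    have hlog1 : -((1.95 / 1518500249) / (1 - 1.95 / 1518500249)) ≤ Real.log (1 - 1.95 / √(q:ℝ)) := by
      refine le_trans ?_ (log_one_sub_ge hu1)
      have : (1.95 / √(q:ℝ)) / (1 - 1.95 / √(q:ℝ)) ≤ (1.95 / 1518500249) / (1 - 1.95 / 1518500249) := by
        gcongr
      linarith
    -- assemble: LHS ≤ (1−2⁻²⁶) e^γ L e^E < e^γ (L − window) ≤ e^γ log θ(q)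
    have key : (1 - 1.490116119384765625e-8) * (L * (1 + 1.08e-8 + 1.08e-8 ^ 2)) <
        L - (1.95 / 1518500249) / (1 - 1.95 / 1518500249) := by
      have hc : (0:ℝ) < 1 - (1 - 1.490116119384765625e-8) * (1 + 1.08e-8 + 1.08e-8 ^ 2) := by
        norm_num
      have h1 := mul_le_mul_of_nonneg_left hL hc.le
      have h2 : (1.95 / 1518500249) / (1 - 1.95 / 1518500249) <
          (1 - (1 - 1.490116119384765625e-8) * (1 + 1.08e-8 + 1.08e-8 ^ 2)) * (41.58:ℝ) := by
        norm_num
      linarith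
    calc ∏ p ∈ Nat.primesLE q, dedekindFactor 26 p
        ≤ (1 - (2 : ℝ)⁻¹ ^ 26) * P := hD
      _ ≤ (1 - (2 : ℝ)⁻¹ ^ 26) * (Real.exp eulerMascheroniConstant * L * Real.exp E) :=
          mul_le_mul_of_nonneg_left hM (by norm_num)
      _ ≤ (1 - (2 : ℝ)⁻¹ ^ 26) * (Real.exp eulerMascheroniConstant * L * (1 + 1.08e-8 + 1.08e-8 ^ 2)) := by
          gcongr
      _ = Real.exp eulerMascheroniConstant *
            ((1 - 1.490116119384765625e-8) * (L * (1 + 1.08e-8 + 1.08e-8 ^ 2))) := by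
          rw [c26]; ring
      _ < Real.exp eulerMascheroniConstant * (L - (1.95 / 1518500249) / (1 - 1.95 / 1518500249)) :=
          mul_lt_mul_of_pos_left key hγ
      _ ≤ Real.exp eulerMascheroniConstant * Real.log (θ (q:ℝ)) :=
          mul_le_mul_of_nonneg_left (by linarith) hγ.le
  · -- BKLNW regime, `q > 10¹⁹`
    push Not at hcase
    have hX : (10:ℝ) ^ 19 ≤ q := hcase.le
    have hLX := log_ge_of_ten_pow_19_le hX
    have hE : E ≤ 1.12e-8 := (mertensRemainder_le_E2 hK hX).trans (E2_le_sharp hc0 hc hX)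
    have hexp : Real.exp E ≤ 1 + 1.12e-8 + 1.12e-8 ^ 2 := by
      have hE' : |E| ≤ 1 ∨ E < -1 := by
        by_cases h : -1 ≤ E
        · exact Or.inl (abs_le.2 ⟨h, by linarith⟩)
        · exact Or.inr (by linarith)
      rcases hE' with h | h
      · calc Real.exp E ≤ 1 + E + E ^ 2 := exp_le_quad h
          _ ≤ 1 + 1.12e-8 + 1.12e-8 ^ 2 := by nlinarith [abs_le.1 h]
      · calc Real.exp E ≤ Real.exp 0 := Real.exp_le_exp.2 (by linarith)
          _ ≤ _ := by norm_num
    -- θ(q) ≥ q (1 − c/L²)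
    have hq0' : (0:ℝ) < q := by linarith
    have hK' : |θ (q:ℝ) - q| < c / L ^ 2 * q := by
      calc |θ (q:ℝ) - q| < c * q / Real.log q ^ 2 := hK q hX
        _ = c / L ^ 2 * q := by rw [hLdef]; ring
    have hv : c / L ^ 2 ≤ 4e-5 / 43.66 ^ 2 := by gcongr
    have hv1 : c / L ^ 2 < 1 := lt_of_le_of_lt hv (by norm_num)
    have hv0 : 0 ≤ c / L ^ 2 := by positivity
    have hθ : (q:ℝ) * (1 - c / L ^ 2) ≤ θ (q:ℝ) := by
      have h2 := (abs_lt.1 hK').1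
      have h3 : (q:ℝ) * (1 - c / L ^ 2) = q - c / L ^ 2 * q := by ring
      rw [h3]; linarith
    have hθpos : 0 < (q:ℝ) * (1 - c / L ^ 2) := mul_pos hq0' (by linarith)
    have hlogθ : L + Real.log (1 - c / L ^ 2) ≤ Real.log (θ (q:ℝ)) := by
      calc L + Real.log (1 - c / L ^ 2) = Real.log ((q:ℝ) * (1 - c / L ^ 2)) := by
            rw [Real.log_mul (by linarith) (by linarith)]
        _ ≤ Real.log (θ (q:ℝ)) := Real.log_le_log hθpos hθ
    have hlog1 : -((4e-5 / 43.66 ^ 2) / (1 - 4e-5 / 43.66 ^ 2)) ≤ Real.log (1 - c / L ^ 2) := by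
      refine le_trans ?_ (log_one_sub_ge hv1)
      have : (c / L ^ 2) / (1 - c / L ^ 2) ≤ (4e-5 / 43.66 ^ 2) / (1 - 4e-5 / 43.66 ^ 2) := by
        gcongr
      linarith
    have key : (1 - 1.490116119384765625e-8) * (L * (1 + 1.12e-8 + 1.12e-8 ^ 2)) <
        L - (4e-5 / 43.66 ^ 2) / (1 - 4e-5 / 43.66 ^ 2) := by
      have hc : (0:ℝ) < 1 - (1 - 1.490116119384765625e-8) * (1 + 1.12e-8 + 1.12e-8 ^ 2) := by
        norm_num
      have hLL : (43.66:ℝ) ≤ L := hLX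
      have h1 := mul_le_mul_of_nonneg_left hLL hc.le
      have h2 : (4e-5 / 43.66 ^ 2) / (1 - 4e-5 / 43.66 ^ 2) <
          (1 - (1 - 1.490116119384765625e-8) * (1 + 1.12e-8 + 1.12e-8 ^ 2)) * (43.66:ℝ) := by
        norm_num
      linarith
    calc ∏ p ∈ Nat.primesLE q, dedekindFactor 26 p
        ≤ (1 - (2 : ℝ)⁻¹ ^ 26) * P := hD
      _ ≤ (1 - (2 : ℝ)⁻¹ ^ 26) * (Real.exp eulerMascheroniConstant * L * Real.exp E) :=
          mul_le_mul_of_nonneg_left hM (by norm_num)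
      _ ≤ (1 - (2 : ℝ)⁻¹ ^ 26) * (Real.exp eulerMascheroniConstant * L * (1 + 1.12e-8 + 1.12e-8 ^ 2)) := by
          gcongr
      _ = Real.exp eulerMascheroniConstant *
            ((1 - 1.490116119384765625e-8) * (L * (1 + 1.12e-8 + 1.12e-8 ^ 2))) := by
          rw [c26]; ring
      _ < Real.exp eulerMascheroniConstant * (L - (4e-5 / 43.66 ^ 2) / (1 - 4e-5 / 43.66 ^ 2)) :=
          mul_lt_mul_of_pos_left key hγ
      _ ≤ Real.exp eulerMascheroniConstant * Real.log (θ (q:ℝ)) :=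
          mul_le_mul_of_nonneg_left (by linarith) hγ.le

/-! ### The route item -/

/-- **`AnalyticLegTwentySix` (item stmt-RiemannHypothesis-24270) holds**: the two θ-prints (Büthe 2018 Thm 2,
BKLNW 2021 §1.2, in hypothesis position) give the Solé–Planat primorial inequality at `t = 26` for every prime
`q ≥ 2^61 − 1`.  BKLNW's display constant `3.79·10⁻⁵` enters through `thetaRelBound_of_bklnw`. [folklore] -/
theorem analyticLegTwentySix_proof :
    Summit.RiemannHypothesis.RiemannHypothesis.Theses.RobinFullPortrait.AnalyticLegTwentySix := by
  intro hB hK q hq hq0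
  exact primorial_bound_26 hB (by norm_num) (by norm_num) (thetaRelBound_of_bklnw hK) hq hq0

/-- **The route's RH-free target `Portrait` (item stmt-RiemannHypothesis-24269) holds** — the rung
«ROBIN · 26-FULL PORTRAIT» is PROVED under the named prints (all three in hypothesis position): assuming Büthe 2018
Thm 2, BKLNW 2021 §1.2 and `RiemannHypothesisUpTo 1.82·10¹⁰`, a least `N > 5040` violating Robin's inequality is
superabundant, divisible by `2^26`, and has `log N > 0.99947·(10¹⁹ − 1)`.  Composition of the tree's
`assembly_proof` (p593685) with `analyticLegTwentySix_proof` (this file) and `rangeLeg_proof` (p593072).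
A rung ∕ frontier record, NOT a statement about the distance to RH; RH is not proved. [folklore] -/
theorem portrait_proof : Summit.RiemannHypothesis.RiemannHypothesis.Theses.RobinFullPortrait.Portrait :=
  (assembly_proof :
      Summit.RiemannHypothesis.RiemannHypothesis.Theses.RobinFullPortrait.AnalyticLegTwentySix →
        Summit.RiemannHypothesis.RiemannHypothesis.Theses.RobinFullPortrait.RangeLeg →
          Summit.RiemannHypothesis.RiemannHypothesis.Theses.RobinFullPortrait.Portrait)
    analyticLegTwentySix_proof rangeLeg_proof

end Leg

end Summit.RiemannHypothesis.RiemannHypothesis.Theorems.RobinFullPortrait
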